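import Literature.NumberTheory.Rogawski1990.ArchOrbFamGExtCornerReaders              -- ★ p851242 (F0P3a-p02 (g21)) (X3-CORE): §2 `…_le_of_uniform_bounds_on_inter`, §3 slices; brings ★ `IteratedFDerivBlockReaderBounds` (F0P3a-p08): `exists_forall_norm_iteratedFDeriv_lineReader_le_of_uniform_on`
import Literature.NumberTheory.Automorphic.ArchRankOneOrbitalFamilyParamOpen        -- ★ p851218 (this seat) (X3-rk1)(ii): open-class `h1 ∕ h2 ∕ hcl` on `U(J)`; brings ★ p851205 localisation, ★ p851143
import Literature.NumberTheory.Automorphic.ArchRankOneCasimirUniformIntervalCayley  -- ★ p851216 (this seat) (X3-rk1)(i): the FIXED-INTERVAL `hunif` on `U(J)` at any `E′`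
import HarnessLib

/-!
# (X3-rk1) (iii) THE RANK-ONE CORNER INSTANCE — one PEELING STEP on `U(J)`: a `C^∞`-BOUNDED open-class family through the Cayley normalised elliptic functional is again
# `C^∞`-bounded on the product region `(S ∩ Q′) × (punctured ½-interval)` (Varadarajan 1977 I §1.12; Bouaziz 1994 §3.1–3.2; Hörmander ALPDO I §1.1, §2.1)

Topic `NumberTheory/Rogawski1990`; namespaces `Literature.Analysis.Calculus` (§1, generic) and `Literature.NumberTheory.Automorphic.UnitaryGroup` (§2).  THEOREMS ONLY (no `def`, no instance,
no notation, no axiom, no named fact, no `sorry`); kernel lane `--kind proof --supports stmt-HodgeConjecture-24833`.  Cell `pub/hodgecm-mathlib`, crux H413 (`stmt-HodgeConjecture-24833`),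
line LH3 (closer stub `stub_N9`), LETTER L1 clause (I₁) at the X′-CORNERS (organ O-L1e of leaf v5), brick **(X3-rk1) (iii)** «nesting = ★ §2 ∘ §3 applied to (ii)» (F0P3a-p02 (g21)'s
split 2026-09-02T11:00:14Z under LH3-plan (g4) RULING #18; author F0P3a-p04 (g24)); consumer: (X3-asm) «peeling over `Fin m`» (F0P3a-p02).

THE MATHEMATICS.  ★ (X3-CORE) §1 (F0P3a-p02) bounds every jet of a reader `z ↦ Φ (g z.1) z.2` on a product region `(S ∩ Q′) ×ˢ (T ∩ T₀)` from (H1)∕(H2)∕`hcl` for an admissible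
class and from `hbd` — normal-jet bounds uniform on the region for EVERY admissible member.  Here `Φ := F` is the `U(J)`-Cayley normalised elliptic orbital integral (★ p851143 text,
centre `z`, Haar right-invariant `μ`), `T := Ioo (−1) 1 ∖ {0}` (`⊆ {sin ≠ 0}`), `T₀ := Icc (−½) ½`, and the admissible class is the **`C^∞`-BOUNDED OPEN CLASS over `(S, Q′, C)`**:
`ContDiffOn ℝ ∞ (uncurry g) (Q′ ×ˢ univ)`, `g q X = 0` for `q ∈ Q′`, `X ∉ C` (`C` compact), and ALL joint jets of `uncurry g` bounded on `(S ∩ Q′) ×ˢ C` — no compactness of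
`S ∩ Q′`, no continuity up to its closure (the inner walls of the corner).  Then: `hcl` = ★ (ii) `openFamily_fderiv_closed` + §1 below (the jets of `∂_v g` are jets of `g` one
order up, ★ Mathlib `norm_iteratedFDerivWithin_fderivWithin`); (H1)∕(H2) = ★ (ii) p851218; `hbd` = ★ (X3-CORE) §2 `…_on_inter` at `E′ := ℓ^∞(↥(S ∩ Q′), E)` with `hunif` = ★ (i)
p851216 `exists_forall_norm_iteratedDeriv_cayley_orbitalIntegral_comp_clm_le_of_mem_Icc` and the slice data = ★ (X3-CORE) §3.  OUTPUT: every jet of `(q, ψ) ↦ F(g q)(ψ)` is bounded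
on `(S ∩ Q′) ×ˢ (T ∩ T₀)` — i.e. the READER IS AGAIN A `C^∞`-BOUNDED OPEN-CLASS FAMILY one level up (parameter `(q, ψ)`, open set `Q′ ×ˢ T`, region `(S ∩ Q′) ×ˢ (T ∩ T₀) =
(S ×ˢ T₀) ∩ (Q′ ×ˢ T)`), which is the shape (X3-asm) peels again after adjoining the next block variable (★ (X3-CORE) §3 slices + a coordinate shuffle).
* §1 (generic) **`norm_iteratedFDeriv_fderiv_apply_le_of_isOpen`** (`‖Dᵐ(y ↦ Df(y)·u)(x)‖ ≤ ‖u‖·‖Dᵐ⁺¹f(x)‖` for `f` `C^∞` on an open set), **`bddAbove_jets_fderiv_apply_of_isOpen`**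
  (the jet-bound clause passes to `∂_v g`).
* §2 (`U(J)`) **`exists_forall_norm_iteratedDeriv_cayley_le_of_jetBounds`** (the `hbd` supplier: normal jets `(F (g q))⁽ᵃ⁾ ψ` bounded for `q ∈ S ∩ Q′`, `0 < |ψ| ≤ ½`),
  **`exists_forall_norm_iteratedFDeriv_cayley_reader_le_of_jetBounds`** (HEAD: all jets of the reader bounded on `(S ∩ Q′) ×ˢ ((Ioo (−1) 1 ∖ {0}) ∩ Icc (−½) ½)`).
HONEST LABEL: HC_CM is proved only modulo the 7 printed citations (2 remaining named inputs: hLiu418 = `stmt-HodgeConjecture-24832`, h413 = `stmt-HodgeConjecture-24833`) until rung 0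
closes; a composition of ★ heads, count-neutral (letter-L1 (I₁)-corner brick; pays nothing by itself).

## References
* [Varadarajan1977] V. S. Varadarajan, *Harmonic Analysis on Real Reductive Groups*, LNM 576 (1977), Part I §1.12.
* [Bouaziz1994IntegralesOrbitales] A. Bouaziz, *Intégrales orbitales sur les groupes de Lie réductifs*, Ann. Sci. ÉNS 27 (1994), §3.1 (I₁)–(I₂) p. 579, §3.2 p. 580.
* [HormanderALPDO1] L. Hörmander, *The Analysis of Linear Partial Differential Operators I*, 2nd ed. (1990), §1.1 Thm. 1.1.8, (1.1.9); §2.1.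
* [Rogawski1990] J. D. Rogawski, *Automorphic Representations of Unitary Groups in Three Variables*, Ann. of Math. Stud. 123 (1990), §8.2 pp. 119–123.
-/

set_option autoImplicit false

noncomputable section

/-! ## §1 Generic: the jets of a directional derivative are jets one order up -/

namespace Literature.Analysis.Calculus

open _root_.Set _root_.Filter _root_.Topology _root_.Function
open scoped ContDiff

section DirDerivJets

variable {V : Type*} [NormedAddCommGroup V] [NormedSpace ℝ V] {F : Type*} [NormedAddCommGroup F] [NormedSpace ℝ F]

/-- **`‖Dᵐ (y ↦ Df(y)·u)(x)‖ ≤ ‖u‖ · ‖Dᵐ⁺¹ f(x)‖`** for `f` `C^∞` on an open `U ∋ x` (on `U`, `fderiv = fderivWithin U` and `iteratedFDeriv = iteratedFDerivWithin U`; Mathlib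
`norm_iteratedFDerivWithin_clm_apply_const` + `norm_iteratedFDerivWithin_fderivWithin`). [cite: HormanderALPDO1, §1.1 (1.1.9)] -/
theorem norm_iteratedFDeriv_fderiv_apply_le_of_isOpen {U : Set V} (hU : IsOpen U) {f : V → F} (hf : ContDiffOn ℝ ∞ f U) {x : V} (hx : x ∈ U) (u : V) (m : ℕ) :
    ‖iteratedFDeriv ℝ m (fun y => fderiv ℝ f y u) x‖ ≤ ‖u‖ * ‖iteratedFDeriv ℝ (m + 1) f x‖ := by
  have hUd : UniqueDiffOn ℝ U := hU.uniqueDiffOn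
  -- replace `fderiv` by `fderivWithin U` and `iteratedFDeriv` by `iteratedFDerivWithin U` on the open set
  have hcongr : EqOn (fun y => fderiv ℝ f y u) (fun y => fderivWithin ℝ f U y u) U := fun y hy => by
    show fderiv ℝ f y u = fderivWithin ℝ f U y u
    rw [fderivWithin_of_isOpen hU hy]
  rw [← iteratedFDerivWithin_of_isOpen m hU hx, ← iteratedFDerivWithin_of_isOpen (m + 1) hU hx, iteratedFDerivWithin_congr hcongr hx]
  have hD : ContDiffWithinAt ℝ ∞ (fderivWithin ℝ f U) U x := (hf.fderivWithin hUd (m := ∞) (by simp)) x hx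
  calc ‖iteratedFDerivWithin ℝ m (fun y => fderivWithin ℝ f U y u) U x‖
      ≤ ‖u‖ * ‖iteratedFDerivWithin ℝ m (fderivWithin ℝ f U) U x‖ := norm_iteratedFDerivWithin_clm_apply_const hD hUd hx (mod_cast le_top)
    _ = ‖u‖ * ‖iteratedFDerivWithin ℝ (m + 1) f U x‖ := by rw [norm_iteratedFDerivWithin_fderivWithin hUd hx]

variable {Q : Type*} [NormedAddCommGroup Q] [NormedSpace ℝ Q] {M : Type*} [NormedAddCommGroup M] [NormedSpace ℝ M]

/-- **The jet-bound clause passes to the parameter derivative**: if all joint jets of `uncurry g` are bounded on `A ⊆ O ×ˢ univ` (`O` open, `g` `C^∞` on `O ×ˢ univ`), so are all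
joint jets of `uncurry (∂_v g)`, `∂_v g q X := fderiv ℝ (q′ ↦ g q′ X) q v` — on `O ×ˢ univ` this is `D(uncurry g)(·)(v, 0)` (★ `fderiv_slice_fst_apply_of_prod`), whose `m`-jets are
`(m+1)`-jets of `uncurry g` (§1). [cite: HormanderALPDO1, §1.1 (1.1.9)] -/
theorem bddAbove_jets_fderiv_apply_of_isOpen {O : Set Q} (hO : IsOpen O) {g : Q → M → F} (hg : ContDiffOn ℝ ∞ (Function.uncurry g) (O ×ˢ (univ : Set M)))
    {A : Set (Q × M)} (hA : A ⊆ O ×ˢ (univ : Set M)) (hb : ∀ m : ℕ, BddAbove ((fun z => ‖iteratedFDeriv ℝ m (Function.uncurry g) z‖) '' A)) (v : Q) (m : ℕ) :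
    BddAbove ((fun z => ‖iteratedFDeriv ℝ m (Function.uncurry fun (q : Q) (X : M) => fderiv ℝ (fun q' : Q => g q' X) q v) z‖) '' A) := by
  have hO' : IsOpen (O ×ˢ (univ : Set M)) := hO.prod isOpen_univ
  obtain ⟨B, hB⟩ := hb (m + 1)
  refine ⟨‖((v, (0 : M)) : Q × M)‖ * B, ?_⟩
  rintro _ ⟨z, hz, rfl⟩
  have hzO : z ∈ O ×ˢ (univ : Set M) := hA hz
  -- on the open set the two functions agree, so their jets at `z` agree
  have heq : EqOn (Function.uncurry fun (q : Q) (X : M) => fderiv ℝ (fun q' : Q => g q' X) q v) (fun y => fderiv ℝ (Function.uncurry g) y (v, (0 : M))) (O ×ˢ (univ : Set M)) :=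
    fun y hy => by
      have hd : DifferentiableAt ℝ (Function.uncurry g) y := (hg.contDiffAt (hO'.mem_nhds hy)).differentiableAt (by simp)
      show fderiv ℝ (fun q' : Q => g q' y.2) y.1 v = fderiv ℝ (Function.uncurry g) y (v, (0 : M))
      exact fderiv_slice_fst_apply_of_prod (G := Function.uncurry g) hd v
  have hev : (Function.uncurry fun (q : Q) (X : M) => fderiv ℝ (fun q' : Q => g q' X) q v) =ᶠ[𝓝 z]
      fun y => fderiv ℝ (Function.uncurry g) y (v, (0 : M)) := Filter.eventuallyEq_of_mem (hO'.mem_nhds hzO) heq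
  have hjet : iteratedFDeriv ℝ m (Function.uncurry fun (q : Q) (X : M) => fderiv ℝ (fun q' : Q => g q' X) q v) z =
      iteratedFDeriv ℝ m (fun y => fderiv ℝ (Function.uncurry g) y (v, (0 : M))) z := (hev.iteratedFDeriv ℝ m).eq_of_nhds
  show ‖iteratedFDeriv ℝ m (Function.uncurry fun (q : Q) (X : M) => fderiv ℝ (fun q' : Q => g q' X) q v) z‖ ≤ ‖((v, (0 : M)) : Q × M)‖ * B
  rw [hjet]
  refine (norm_iteratedFDeriv_fderiv_apply_le_of_isOpen hO' hg hzO (v, (0 : M)) m).trans ?_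
  exact mul_le_mul_of_nonneg_left (hB ⟨z, hz, rfl⟩) (norm_nonneg _)

end DirDerivJets

end Literature.Analysis.Calculus

/-! ## §2 The rank-one corner instance on `U(J)`: one peeling step -/

namespace Literature.NumberTheory.Automorphic

namespace UnitaryGroup

open _root_.MeasureTheory _root_.MeasureTheory.Measure _root_.Set _root_.Filter _root_.Topology _root_.Complex
open _root_.Literature.Analysis.Calculus _root_.Literature.NumberTheory.Automorphic.RankOneCasimir
open scoped MatrixGroups ContDiff ComplexConjugate ENNReal
open scoped Matrix.Norms.Operator

variable {J : Matrix (Fin 2) (Fin 2) ℂ} (hJ : J = (StdForm.antidiagonal 2).over ℂ)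
  [MeasurableSpace ↥(unitaryGroupOfForm (starRingEnd ℂ) J)] [BorelSpace ↥(unitaryGroupOfForm (starRingEnd ℂ) J)]
  {E : Type} [NormedAddCommGroup E] [NormedSpace ℝ E] [CompleteSpace E]
  {P : Type} [NormedAddCommGroup P] [NormedSpace ℝ P] [FiniteDimensional ℝ P]

omit [FiniteDimensional ℝ P] in
include hJ in
/-- **THE `hbd` SUPPLIER (★ (X3-CORE) §2 ∘ §3 ∘ (X3-rk1)(i)).**  `F` the `U(J)`-Cayley normalised elliptic functional (Haar right-invariant `μ`, centre `z`); `g : P → M₂(ℂ) → E` with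
`ContDiffOn ℝ ∞ (uncurry g) (Q′ ×ˢ univ)` (`Q′` open), supported in the compact `C` for `q ∈ Q′`, and ALL joint jets of `uncurry g` bounded on `(S ∩ Q′) ×ˢ C`.  Then for every order `a`:
**`∃ B, ∀ q ∈ S ∩ Q′, ∀ ψ ∈ Icc (−½) ½ ∖ {0}, ‖(F (g q))⁽ᵃ⁾ ψ‖ ≤ B`** (slices `X ↦ g q X` are a `C^∞`-bounded family on `C` by ★ §3; ★ §2 `…_on_inter` at `E′ := ℓ^∞(↥(S ∩ Q′), E)` with the
fixed-interval `hunif` ★ `exists_forall_norm_iteratedDeriv_cayley_orbitalIntegral_comp_clm_le_of_mem_Icc`). [cite: Bouaziz1994IntegralesOrbitales, §3.1 (I₁)–(I₂) p. 579]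
[cite: Varadarajan1977, Part I §1.12] [cite: HormanderALPDO1, §2.1] -/
theorem exists_forall_norm_iteratedDeriv_cayley_le_of_jetBounds (μ : Measure ↥(unitaryGroupOfForm (starRingEnd ℂ) J)) [μ.IsHaarMeasure] [μ.IsMulRightInvariant]
    (z : Circle) (F : (Matrix (Fin 2) (Fin 2) ℂ → E) → ℝ → E)
    (hF : ∀ (f : Matrix (Fin 2) (Fin 2) ℂ → E) (ψ : ℝ), F f ψ = (2 * Real.sin ψ) •
      ∫ h : ↥(unitaryGroupOfForm (starRingEnd ℂ) J),
        f (((h * ⟨Matrix.GeneralLinearGroup.mkOfDetNeZero !![(1 : ℂ), 1; 1, -1] det_cayleyTwo_ne_zero *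
              circleDiagonal 2 ![z * Circle.exp ψ, z * Circle.exp (-ψ)] * (Matrix.GeneralLinearGroup.mkOfDetNeZero !![(1 : ℂ), 1; 1, -1] det_cayleyTwo_ne_zero)⁻¹,
            cayley_conj_circleDiagonal_mem_of_eq_over hJ _⟩ * h⁻¹ : ↥(unitaryGroupOfForm (starRingEnd ℂ) J)) : GL (Fin 2) ℂ) : Matrix (Fin 2) (Fin 2) ℂ) ∂μ)
    {Q' : Set P} (hQ' : IsOpen Q') (S : Set P) (g : P → Matrix (Fin 2) (Fin 2) ℂ → E)
    (hg : ContDiffOn ℝ ∞ (Function.uncurry g) (Q' ×ˢ (univ : Set (Matrix (Fin 2) (Fin 2) ℂ))))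
    {C : Set (Matrix (Fin 2) (Fin 2) ℂ)} (hC : IsCompact C) (h0 : ∀ q ∈ Q', ∀ X : Matrix (Fin 2) (Fin 2) ℂ, X ∉ C → g q X = 0)
    (hjb : ∀ m : ℕ, BddAbove ((fun w => ‖iteratedFDeriv ℝ m (Function.uncurry g) w‖) '' ((S ∩ Q') ×ˢ C))) (a : ℕ) :
    ∃ B : ℝ, ∀ q ∈ S ∩ Q', ∀ ψ ∈ Icc (-(1 / 2 : ℝ)) (1 / 2) ∩ {(0 : ℝ)}ᶜ, ‖iteratedDeriv a (F (g q)) ψ‖ ≤ B := by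
  have hO : IsOpen (Q' ×ˢ (univ : Set (Matrix (Fin 2) (Fin 2) ℂ))) := hQ'.prod isOpen_univ
  have hSC : (S ∩ Q') ×ˢ C ⊆ Q' ×ˢ (univ : Set (Matrix (Fin 2) (Fin 2) ℂ)) := Set.prod_mono Set.inter_subset_right (Set.subset_univ _)
  -- the fixed-interval `hunif` at `E′ := ℓ^∞(↥(S ∩ Q′), E)` (★ (X3-rk1)(i))
  have hunif : ∀ G : Matrix (Fin 2) (Fin 2) ℂ → lp (fun _ : ↥(S ∩ Q') => E) ⊤, ContDiff ℝ ∞ G → HasCompactSupport G →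
      ∃ B : ℝ, ∀ ψ ∈ Icc (-(1 / 2 : ℝ)) (1 / 2) ∩ {(0 : ℝ)}ᶜ, ∀ ℓ : lp (fun _ : ↥(S ∩ Q') => E) ⊤ →L[ℝ] E,
        ‖iteratedDeriv a (F (fun X => ℓ (G X))) ψ‖ ≤ ‖ℓ‖ * B := fun G hG hGc =>
    exists_forall_norm_iteratedDeriv_cayley_orbitalIntegral_comp_clm_le_of_mem_Icc (E := E) (E' := lp (fun _ : ↥(S ∩ Q') => E) ⊤) hJ μ z F hF
      (fun (G' : Matrix (Fin 2) (Fin 2) ℂ → lp (fun _ : ↥(S ∩ Q') => E) ⊤) (ψ : ℝ) => (2 * Real.sin ψ) •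
        ∫ h : ↥(unitaryGroupOfForm (starRingEnd ℂ) J),
          G' (((h * ⟨Matrix.GeneralLinearGroup.mkOfDetNeZero !![(1 : ℂ), 1; 1, -1] det_cayleyTwo_ne_zero *
                circleDiagonal 2 ![z * Circle.exp ψ, z * Circle.exp (-ψ)] * (Matrix.GeneralLinearGroup.mkOfDetNeZero !![(1 : ℂ), 1; 1, -1] det_cayleyTwo_ne_zero)⁻¹,
              cayley_conj_circleDiagonal_mem_of_eq_over hJ _⟩ * h⁻¹ : ↥(unitaryGroupOfForm (starRingEnd ℂ) J)) : GL (Fin 2) ℂ) : Matrix (Fin 2) (Fin 2) ℂ) ∂μ)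
      (fun _ _ => rfl) hG hGc a
  -- the slices over `S ∩ Q′` are a `C^∞`-bounded family on `C` (★ (X3-CORE) §3)
  have hgs : ∀ q ∈ S ∩ Q', ContDiff ℝ ∞ (g q) := fun q hq => contDiff_slice_of_contDiffOn_prod_univ (Function.uncurry g) hg hq.2
  have hsupp : ∀ q ∈ S ∩ Q', tsupport (g q) ⊆ C := fun q hq => tsupport_slice_subset (Function.uncurry g) hC.isClosed (fun X hX => h0 q hq.2 X hX)
  have hbd : ∀ m : ℕ, ∃ B : ℝ, ∀ q ∈ S ∩ Q', ∀ X ∈ C, ‖iteratedFDeriv ℝ m (g q) X‖ ≤ B := fun m =>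
    exists_forall_slice_bounds_of_bddAbove (Function.uncurry g) hO hg (S ∩ Q') C hSC hjb m
  exact exists_forall_norm_iteratedDeriv_le_of_uniform_bounds_on_inter F a S Q' _ hunif g hgs hC hsupp hbd

include hJ in
/-- **(X3-rk1) (iii) HEAD — ONE PEELING STEP ON `U(J)`.**  `F` the `U(J)`-Cayley normalised elliptic functional (Haar right-invariant `μ`, centre `z`); `g` a `C^∞`-BOUNDED OPEN-CLASS
family over `(S, Q′, C)` (smooth on `Q′ ×ˢ univ`, supported in `C` on `Q′`, all joint jets bounded on `(S ∩ Q′) ×ˢ C`).  Then EVERY jet of the reader `(q, ψ) ↦ F(g q)(ψ)` is bounded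
on the product region: **`∀ k, ∃ B, ∀ w ∈ (S ∩ Q′) ×ˢ ((Ioo (−1) 1 ∖ {0}) ∩ Icc (−½) ½), ‖Dᵏ[(q,ψ) ↦ F(g q)(ψ)](w)‖ ≤ B`** — ★ (X3-CORE) §1 with the `C^∞`-bounded open class as `Adm`
(closed under `D v` by ★ (ii) `openFamily_fderiv_closed` + §1), (H1)∕(H2) = ★ (ii) p851218, `hbd` = the supplier above.  The conclusion is again a jet bound on
`(S ×ˢ Icc) ∩ (Q′ ×ˢ (Ioo ∖ {0}))`, the input shape of the next peeling step. [cite: Varadarajan1977, Part I §1.12] [cite: Bouaziz1994IntegralesOrbitales, §3.2 p. 580]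
[cite: HormanderALPDO1, §1.1 Thm. 1.1.8, (1.1.9)] -/
theorem exists_forall_norm_iteratedFDeriv_cayley_reader_le_of_jetBounds (μ : Measure ↥(unitaryGroupOfForm (starRingEnd ℂ) J)) [μ.IsHaarMeasure] [μ.IsMulRightInvariant]
    (z : Circle) (F : (Matrix (Fin 2) (Fin 2) ℂ → E) → ℝ → E)
    (hF : ∀ (f : Matrix (Fin 2) (Fin 2) ℂ → E) (ψ : ℝ), F f ψ = (2 * Real.sin ψ) •
      ∫ h : ↥(unitaryGroupOfForm (starRingEnd ℂ) J),
        f (((h * ⟨Matrix.GeneralLinearGroup.mkOfDetNeZero !![(1 : ℂ), 1; 1, -1] det_cayleyTwo_ne_zero *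
              circleDiagonal 2 ![z * Circle.exp ψ, z * Circle.exp (-ψ)] * (Matrix.GeneralLinearGroup.mkOfDetNeZero !![(1 : ℂ), 1; 1, -1] det_cayleyTwo_ne_zero)⁻¹,
            cayley_conj_circleDiagonal_mem_of_eq_over hJ _⟩ * h⁻¹ : ↥(unitaryGroupOfForm (starRingEnd ℂ) J)) : GL (Fin 2) ℂ) : Matrix (Fin 2) (Fin 2) ℂ) ∂μ)
    {Q' : Set P} (hQ' : IsOpen Q') (S : Set P) (g : P → Matrix (Fin 2) (Fin 2) ℂ → E)
    (hg : ContDiffOn ℝ ∞ (Function.uncurry g) (Q' ×ˢ (univ : Set (Matrix (Fin 2) (Fin 2) ℂ))))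
    {C : Set (Matrix (Fin 2) (Fin 2) ℂ)} (hC : IsCompact C) (h0 : ∀ q ∈ Q', ∀ X : Matrix (Fin 2) (Fin 2) ℂ, X ∉ C → g q X = 0)
    (hjb : ∀ m : ℕ, BddAbove ((fun w => ‖iteratedFDeriv ℝ m (Function.uncurry g) w‖) '' ((S ∩ Q') ×ˢ C))) (k : ℕ) :
    ∃ B : ℝ, ∀ w ∈ (S ∩ Q') ×ˢ ((Ioo (-1 : ℝ) 1 ∩ {(0 : ℝ)}ᶜ) ∩ Icc (-(1 / 2 : ℝ)) (1 / 2)),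
      ‖iteratedFDeriv ℝ k (fun w : P × ℝ => F (g w.1) w.2) w‖ ≤ B := by
  have hT : IsOpen (Ioo (-1 : ℝ) 1 ∩ {(0 : ℝ)}ᶜ) := isOpen_Ioo.inter isOpen_compl_singleton
  have hTs : Ioo (-1 : ℝ) 1 ∩ {(0 : ℝ)}ᶜ ⊆ {ψ : ℝ | Real.sin ψ ≠ 0} := fun ψ hψ hs =>
    hψ.2 ((Real.sin_eq_zero_iff_of_lt_of_lt (by linarith [hψ.1.1, Real.pi_gt_three]) (by linarith [hψ.1.2, Real.pi_gt_three])).1 hs)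
  have hO : IsOpen (Q' ×ˢ (univ : Set (Matrix (Fin 2) (Fin 2) ℂ))) := hQ'.prod isOpen_univ
  have hSC : (S ∩ Q') ×ˢ C ⊆ Q' ×ˢ (univ : Set (Matrix (Fin 2) (Fin 2) ℂ)) := Set.prod_mono Set.inter_subset_right (Set.subset_univ _)
  -- ★ (X3-CORE) §1 (= ★ `…lineReader…`) with the `C^∞`-bounded open class over `(S, Q′, C)`
  refine exists_forall_norm_iteratedFDeriv_lineReader_le_of_uniform_on hQ' hT F
    (fun g' : P → Matrix (Fin 2) (Fin 2) ℂ → E =>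
      (ContDiffOn ℝ ∞ (Function.uncurry g') (Q' ×ˢ (univ : Set (Matrix (Fin 2) (Fin 2) ℂ))) ∧
        ∃ C' : Set (Matrix (Fin 2) (Fin 2) ℂ), IsCompact C' ∧ ∀ q ∈ Q', ∀ X : Matrix (Fin 2) (Fin 2) ℂ, X ∉ C' → g' q X = 0) ∧
      (∀ q ∈ Q', ∀ X : Matrix (Fin 2) (Fin 2) ℂ, X ∉ C → g' q X = 0) ∧
      ∀ m : ℕ, BddAbove ((fun w => ‖iteratedFDeriv ℝ m (Function.uncurry g') w‖) '' ((S ∩ Q') ×ˢ C)))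
    (fun (v : P) (g' : P → Matrix (Fin 2) (Fin 2) ℂ → E) => fun q X => fderiv ℝ (fun q' : P => g' q' X) q v)
    ?_ ?_ ?_ S (Icc (-(1 / 2 : ℝ)) (1 / 2)) ?_ g ⟨⟨hg, C, hC, h0⟩, h0, hjb⟩ k
  · -- `hcl`
    rintro g' ⟨hg', h0', hjb'⟩ v
    exact ⟨openFamily_fderiv_closed (E := E) hQ' hg' v, forall_fderiv_apply_eq_zero_of_support_isOpen hQ' h0' v,
      bddAbove_jets_fderiv_apply_of_isOpen hQ' hg'.1 hSC hjb' v⟩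
  · -- `h1`
    rintro g' ⟨hg', -, -⟩
    exact (contDiffOn_cayley_orbitalIntegral_param_of_isOpen hJ μ z F hF hQ' g' hg'.1 hg'.2).mono (Set.prod_mono le_rfl hTs)
  · -- `h2`
    rintro g' ⟨hg', -, -⟩ v x hx
    exact fderiv_cayley_orbitalIntegral_param_prod_apply_of_isOpen hJ μ z F hF hQ' g' hg'.1 hg'.2 v
      (Set.mem_prod.2 ⟨(Set.mem_prod.1 hx).1, hTs (Set.mem_prod.1 hx).2⟩)
  · -- `hbd` for every member of the class
    rintro g' ⟨hg', h0', hjb'⟩ a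
    obtain ⟨B, hB⟩ := exists_forall_norm_iteratedDeriv_cayley_le_of_jetBounds hJ μ z F hF hQ' S g' hg'.1 hC h0' hjb' a
    exact ⟨B, fun q hq ψ hψ => hB q hq ψ ⟨hψ.2, hψ.1.2⟩⟩

end UnitaryGroup

end Literature.NumberTheory.Automorphic

end
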